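import Summits.Ventures.LatticeQCDFlow.Exactness.BernsteinInequality
import Summits.Ventures.LatticeQCDFlow.Exactness.IMHCoupledEstimatorBurnInHoeffding
import Summits.Ventures.LatticeQCDFlow.Exactness.IMHCoupledTimeAverageEstimator
import Summits.Ventures.LatticeQCDFlow.Exactness.IMHAnyStartMSE
import HarnessLib

/-!
# The certified cost of a measurement: Bernstein for `R` independent time-averaged coupled estimates —
# `P(|R⁻¹Σ_j H̄_L(Z_j) − π f| ≥ ε + r^k(c − a)) ≤ 2·exp(−Rε²/(2(σ_L² + (c − a)ε/3))) + R·r^k·p₀`, `σ_L² = (2W − 1)Var_π f/L + r^k D²`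

HONEST FRAMING: exact (Metropolis-corrected) sampling algorithms for lattice gauge theory;
figures of merit are autocorrelation/cost numbers at stated couplings and volumes; no
continuum-physics claim.

Venture `LatticeQCDFlow` (cell pub-lqcd), topic `Exactness`; FANOUT row 30 (lean-1, GEN-40).  NEW WORK of the cell, general state space
with `MeasurableEq Ω`; sequel to this generation's `Exactness/BernsteinInequality` ∕ `…IMHCoupledEstimatorBernstein` (Bernstein bar for the
burn-in read-out `f(Y_k)`: exponent `Rε²/(2(Var_π f + …))`) and to GEN-37's `Exactness/IMHCoupledTimeAverageEstimator` ∕ GEN-39's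
`…MedianCertificate` (the time-averaged coupled estimate `H̄_L = (1/L)Σ_{l<L}(f(Y_{k+l}) + Σ_{n<N} D_{k+l+n})` of ONE pair; the median trick
with constants `8`, `exp(−R/8)`).  Setting: exact sampler `K = indepMH q w`, `w` normalised and maximal at `x₀`, `W = w(x₀)`, `r = 1 − 1/W`;
CRN pair kernel `K̂`, pair path law `P̂` from an initial coupling `ν̂`, `p₀ = ν̂(Δᶜ)`; `R` mutually independent pair streams `Z_j` with law `P̂`;
`a ≤ f ≤ c` measurable, `π f` its equilibrium mean, `Var_π f` its equilibrium variance, `D = max(π f − a, c − π f)`; window `L ≥ 1` after `k`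
burn-in updates; the WINDOW READ-OUT AVERAGE `A_L(z) = (1/L)Σ_{l<L} f((z(k+l)).2) ∈ [a, c]`.

* §1 (bookkeeping ∕ transfer) **`measurable_windowReadout`**, **`windowReadout_mem_Icc`**; **`windowReadout_integral_sub_abs_le`** — the common
  mean `m_L = E_{P̂} A_L` is within `r^k(c − a)` of `π f`; **`windowReadout_variance_le`** — THE WINDOW VARIANCE IS AN AUTOCORRELATION QUANTITY:
  `Var_{P̂} A_L ≤ σ_L² := (2W − 1)Var_π f/L + r^k D²` from every start (GEN-35's any-start window MSE `imh_chain_windowMSE_anyStart_le_explicit`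
  — the IMH integrated-autocorrelation factor `2W − 1 = 2/A − 1` — read on the second coordinate of the pair chain, which IS a run);
  **`windowReadout_replica_variance_eq`** [transfer along the law].
* §2 **`windowReadout_replicas_bernstein_abs`** — Bernstein across replicas for the window read-out averages:
  `P(|R⁻¹Σ_j A_L(Z_j) − m_L| ≥ ε) ≤ 2·exp(−Rε²/(2(σ² + (c − a)ε/3)))` for every `σ² ≥ Var_{P̂} A_L`, `σ² > 0`.
* §3 **`crnLagAvg_replicas_burnIn_bernstein_abs_target`** — THE COUPLED, BURN-IN-CERTIFIED VERSION ABOUT `π f`: off the event that some replica's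
  runs still differ at a time `≥ k` (probability `≤ R·r^k·p₀`, GEN-39) every correction vanishes and `H̄_L(Z_j) = A_L(Z_j)`, so
  `P(|R⁻¹Σ_j H̄_L(Z_j) − π f| ≥ ε + r^k(c − a)) ≤ 2·exp(−Rε²/(2(σ² + (c − a)ε/3))) + R·r^k·p₀`;
  **`crnLagAvg_replicas_burnIn_bernstein_cost`** — with `σ² = σ_L² = (2W − 1)Var_π f/L + r^k D²` (assumed positive): for small `ε` and large `k`
  the exponent is `R·L·ε²/(2(2W − 1)Var_π f)·(1 + o(1))`: THE TOTAL BUDGET `R·L` OF UPDATE ROUNDS THAT CERTIFIES ACCURACY `ε` AT CONFIDENCE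
  `1 − δ` IS `≈ 2(2W − 1)·Var_π f·log(2/δ)/ε²` — the i.i.d. sample size `Var_π f/ε²` times the exact sampler's integrated-autocorrelation bound
  `2W − 1` times `2 log(2/δ)`; GEN-39's median certificate needed `8(2W − 1)Var_π f/s²` rounds per replica and `8 log(1/δ)` replicas.
Reading (gauge files): `R` independent coupled pairs of two exact gauge samplers, each time-averaged over `L` rounds after `k` discarded ones,
certify a bounded observable to accuracy `ε` with confidence `1 − δ` at a total cost of about `2(2/A − 1)·Var_π f·log(2/δ)/ε²` rounds.
NOT CLAIMED: an empirical-variance version (σ² from the data); the optimal split between `R` and `L` beyond the displayed exponent; unbounded `f`;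
any value of `A`.  No `sorry`, no new definitions, nothing cited as a fact.
-/

noncomputable section

namespace Summit.Ventures.LatticeQCDFlow.Exactness

open MeasureTheory ProbabilityTheory Function Finset Filter
open scoped ENNReal unitInterval Topology NNReal
open Summit.Ventures.LatticeQCDFlow.Scoring

variable {Ω : Type*} [MeasurableSpace Ω] {q : Measure Ω} [IsProbabilityMeasure q] {w : Ω → ℝ}

/-! ## §1 The window read-out average: range, mean, variance -/

omit [IsProbabilityMeasure q] in
/-- Measurability of the window read-out average `z ↦ (Σ_{l<L} f((z(k+l)).2))/L`. [ours, bookkeeping] -/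
theorem measurable_windowReadout {f : Ω → ℝ} (hf : Measurable f) (k L : ℕ) :
    Measurable fun z : ℕ → Ω × Ω => (∑ l ∈ range L, f ((z (k + l)).2)) / L :=
  (Finset.measurable_sum _ fun l _ => hf.comp (measurable_snd.comp (measurable_pi_apply (k + l)))).div_const _

omit [MeasurableSpace Ω] [IsProbabilityMeasure q] in
/-- `a ≤ A_L(z) ≤ c` for `a ≤ f ≤ c` and `L ≥ 1`. [ours, bookkeeping] -/
theorem windowReadout_mem_Icc {f : Ω → ℝ} {a c : ℝ} (ha : ∀ x, a ≤ f x) (hc : ∀ x, f x ≤ c) (k : ℕ) {L : ℕ} (hL : L ≠ 0)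
    (z : ℕ → Ω × Ω) : (∑ l ∈ range L, f ((z (k + l)).2)) / L ∈ Set.Icc a c := by
  have hLpos : (0 : ℝ) < L := by exact_mod_cast Nat.pos_of_ne_zero hL
  constructor
  · rw [le_div_iff₀ hLpos]
    calc a * L = ∑ _l ∈ range L, a := by rw [sum_const, card_range, nsmul_eq_mul, mul_comm]
      _ ≤ ∑ l ∈ range L, f ((z (k + l)).2) := sum_le_sum fun l _ => ha _
  · rw [div_le_iff₀ hLpos]
    calc ∑ l ∈ range L, f ((z (k + l)).2) ≤ ∑ _l ∈ range L, c := sum_le_sum fun l _ => hc _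
      _ = c * L := by rw [sum_const, card_range, nsmul_eq_mul, mul_comm]

/-- **THE WINDOW MEAN IS WITHIN `r^k(c − a)` OF `π f`** (every initial coupling): `|E_{P̂} A_L − π f| ≤ r^k(c − a)`. [ours] -/
theorem windowReadout_integral_sub_abs_le [Fact (Measurable w)] (hw0 : ∀ y, 0 < w y) {x₀ : Ω} (hmax : ∀ y, w y ≤ w x₀)
    [IsProbabilityMeasure (q.withDensity fun y => ENNReal.ofReal (w y))]
    (Khat : Kernel (Ω × Ω) (Ω × Ω)) [IsMarkovKernel Khat]
    (hK : ∀ z : Ω × Ω, Khat z = (q.prod (volume : Measure unitInterval)).map (fun p : Ω × unitInterval =>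
      ((if (p.2 : ℝ) * w z.1 ≤ w p.1 then p.1 else z.1), (if (p.2 : ℝ) * w z.2 ≤ w p.1 then p.1 else z.2))))
    (μ₀ : Measure (Ω × Ω)) [IsProbabilityMeasure μ₀] {f : Ω → ℝ} (hf : Measurable f) {a c : ℝ}
    (ha : ∀ x, a ≤ f x) (hc : ∀ x, f x ≤ c) (k : ℕ) {L : ℕ} (hL : L ≠ 0) :
    |∫ z, (∑ l ∈ range L, f ((z (k + l)).2)) / L
        ∂(Kernel.trajMeasure (X := fun _ : ℕ => Ω × Ω) μ₀
          (fun n : ℕ => Khat.comap (fun h : (i : ↥(Finset.Iic n)) → Ω × Ω => h ⟨n, Finset.mem_Iic.2 le_rfl⟩)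
            (measurable_pi_apply _))) - ∫ x, f x ∂(q.withDensity fun y => ENNReal.ofReal (w y))| ≤
      (1 - (w x₀)⁻¹) ^ k * (c - a) := by
  haveI : IsProbabilityMeasure (μ₀.map Prod.snd) := Measure.isProbabilityMeasure_map measurable_snd.aemeasurable
  set P := Kernel.trajMeasure (X := fun _ : ℕ => Ω × Ω) μ₀
    (fun n : ℕ => Khat.comap (fun h : (i : ↥(Finset.Iic n)) → Ω × Ω => h ⟨n, Finset.mem_Iic.2 le_rfl⟩)
      (measurable_pi_apply _)) with hP
  haveI : IsProbabilityMeasure P := by rw [hP]; infer_instance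
  set πf := ∫ x, f x ∂(q.withDensity fun y => ENNReal.ofReal (w y)) with hπf
  have hC : ∀ x, |f x| ≤ max |a| |c| := fun x => abs_le_max_abs_abs (ha x) (hc x)
  have hLpos : (0 : ℝ) < L := by exact_mod_cast Nat.pos_of_ne_zero hL
  have hW : 1 ≤ w x₀ := one_le_of_mode (q := q) hmax
  have hr0 : 0 ≤ 1 - (w x₀)⁻¹ := sub_nonneg.2 (inv_le_one_of_one_le₀ hW)
  have hr1 : 1 - (w x₀)⁻¹ ≤ 1 := sub_le_self _ (inv_nonneg.2 (zero_le_one.trans hW))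
  have hFi : ∀ l, Integrable (fun z : ℕ → Ω × Ω => f ((z (k + l)).2)) P := fun l =>
    Integrable.of_bound ((hf.comp (measurable_snd.comp (measurable_pi_apply (k + l)))).aestronglyMeasurable) (max |a| |c|)
      (ae_of_all _ fun z => by rw [Real.norm_eq_abs]; exact hC _)
  -- the mean of the window average is the average of the per-time means
  set u : ℕ → ℝ := fun M => ∫ y, f y ∂((fun m : Measure Ω => m.bind (indepMH q w))^[M] (μ₀.map Prod.snd)) with hu
  have hmean : ∫ z, (∑ l ∈ range L, f ((z (k + l)).2)) / L ∂P = (∑ l ∈ range L, u (k + l)) / L := by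
    rw [integral_div, integral_finsetSum _ fun l _ => hFi l]
    congr 1
    exact sum_congr rfl fun l _ => crnLag_integral_snd_eq hw0 Khat hK μ₀ hf hC (k + l)
  rw [hmean]
  have hca : 0 ≤ c - a := by linarith [ha x₀, hc x₀]
  have hper : ∀ l ∈ range L, |u (k + l) - πf| ≤ (1 - (w x₀)⁻¹) ^ k * (c - a) := fun l _ =>
    calc |u (k + l) - πf|
        ≤ (1 - (w x₀)⁻¹) ^ (k + l) * (c - a) := integral_iterate_bind_indepMH_abs_le Fact.out hw0 hmax (k + l) (μ₀.map Prod.snd) hf ha hc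
      _ ≤ (1 - (w x₀)⁻¹) ^ k * (c - a) := by
          rw [pow_add]
          exact mul_le_mul_of_nonneg_right (mul_le_of_le_one_right (pow_nonneg hr0 _) (pow_le_one₀ hr0 hr1)) hca
  have hrew : (∑ l ∈ range L, u (k + l)) / L - πf = (∑ l ∈ range L, (u (k + l) - πf)) / L := by
    rw [sum_sub_distrib, sum_const, card_range, nsmul_eq_mul, sub_div, mul_div_cancel_left₀ _ hLpos.ne']
  rw [hrew, abs_div, abs_of_pos hLpos, div_le_iff₀ hLpos]
  calc |∑ l ∈ range L, (u (k + l) - πf)| ≤ ∑ l ∈ range L, |u (k + l) - πf| := abs_sum_le_sum_abs _ _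
    _ ≤ ∑ _l ∈ range L, (1 - (w x₀)⁻¹) ^ k * (c - a) := sum_le_sum hper
    _ = (1 - (w x₀)⁻¹) ^ k * (c - a) * L := by rw [sum_const, card_range, nsmul_eq_mul, mul_comm]

/-- **THE WINDOW VARIANCE IS AN AUTOCORRELATION QUANTITY**: from every initial coupling,
`Var_{P̂} A_L ≤ σ_L² := (2W − 1)Var_π f/L + r^k·max(π f − a, c − π f)²` (`L ≥ 1`) — GEN-35's any-start window MSE of ONE run, read on the
second coordinate of the pair chain, bounds the variance (`Var ≤` second moment about `π f`). [ours] -/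
theorem windowReadout_variance_le [Fact (Measurable w)] (hw0 : ∀ y, 0 < w y) {x₀ : Ω} (hmax : ∀ y, w y ≤ w x₀)
    [IsProbabilityMeasure (q.withDensity fun y => ENNReal.ofReal (w y))]
    (Khat : Kernel (Ω × Ω) (Ω × Ω)) [IsMarkovKernel Khat]
    (hK : ∀ z : Ω × Ω, Khat z = (q.prod (volume : Measure unitInterval)).map (fun p : Ω × unitInterval =>
      ((if (p.2 : ℝ) * w z.1 ≤ w p.1 then p.1 else z.1), (if (p.2 : ℝ) * w z.2 ≤ w p.1 then p.1 else z.2))))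
    (μ₀ : Measure (Ω × Ω)) [IsProbabilityMeasure μ₀] {f : Ω → ℝ} (hf : Measurable f) {a c : ℝ}
    (ha : ∀ x, a ≤ f x) (hc : ∀ x, f x ≤ c) (k : ℕ) {L : ℕ} (hL : L ≠ 0) :
    variance (fun z : ℕ → Ω × Ω => (∑ l ∈ range L, f ((z (k + l)).2)) / L)
        (Kernel.trajMeasure (X := fun _ : ℕ => Ω × Ω) μ₀
          (fun n : ℕ => Khat.comap (fun h : (i : ↥(Finset.Iic n)) → Ω × Ω => h ⟨n, Finset.mem_Iic.2 le_rfl⟩)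
            (measurable_pi_apply _))) ≤
      (2 * w x₀ - 1) *
          (∫ x, (f x - ∫ z, f z ∂(q.withDensity fun y => ENNReal.ofReal (w y))) ^ 2
            ∂(q.withDensity fun y => ENNReal.ofReal (w y))) / L +
        (1 - (w x₀)⁻¹) ^ k *
          (max (∫ z, f z ∂(q.withDensity fun y => ENNReal.ofReal (w y)) - a)
            (c - ∫ z, f z ∂(q.withDensity fun y => ENNReal.ofReal (w y)))) ^ 2 := by
  haveI : IsProbabilityMeasure (μ₀.map Prod.snd) := Measure.isProbabilityMeasure_map measurable_snd.aemeasurable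
  set P := Kernel.trajMeasure (X := fun _ : ℕ => Ω × Ω) μ₀
    (fun n : ℕ => Khat.comap (fun h : (i : ↥(Finset.Iic n)) → Ω × Ω => h ⟨n, Finset.mem_Iic.2 le_rfl⟩)
      (measurable_pi_apply _)) with hP
  haveI : IsProbabilityMeasure P := by rw [hP]; infer_instance
  set πf := ∫ x, f x ∂(q.withDensity fun y => ENNReal.ofReal (w y)) with hπf
  have hAm : Measurable fun z : ℕ → Ω × Ω => (∑ l ∈ range L, f ((z (k + l)).2)) / L := measurable_windowReadout hf k L
  have hmem : MemLp (fun z : ℕ → Ω × Ω => (∑ l ∈ range L, f ((z (k + l)).2)) / L) 2 P :=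
    memLp_of_bounded (ae_of_all _ fun z => windowReadout_mem_Icc ha hc k hL z) hAm.aestronglyMeasurable 2
  -- (1) `Var ≤` the second moment about `π f`
  have h1 := variance_le_integral_sub_sq (μ := P) hmem πf
  -- (2) the second coordinate IS a run: transfer the window MSE of one run
  have hgm : Measurable (fun x : ℕ → Ω => ((∑ l ∈ range L, f (x (k + l))) / L - πf) ^ 2) :=
    (((Finset.measurable_sum _ fun l _ => hf.comp (measurable_pi_apply (k + l))).div_const _).sub
      measurable_const).pow_const 2
  have hφ : Measurable (fun (z : ℕ → Ω × Ω) (n : ℕ) => (z n).2) :=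
    measurable_pi_lambda _ fun n => measurable_snd.comp (measurable_pi_apply n)
  have hE : ∫ z, ((∑ l ∈ range L, f ((z (k + l)).2)) / L - πf) ^ 2 ∂P =
      ∫ x, ((∑ l ∈ range L, f (x (k + l))) / L - πf) ^ 2
        ∂(Kernel.trajMeasure (X := fun _ : ℕ => Ω) (μ₀.map Prod.snd)
          (fun n : ℕ => (indepMH q w).comap (fun h : (i : ↥(Finset.Iic n)) → Ω => h ⟨n, Finset.mem_Iic.2 le_rfl⟩)
            (measurable_pi_apply _))) := by
    rw [hP, ← crn_chain_map_snd hw0 Khat hK μ₀, integral_map hφ.aemeasurable hgm.aestronglyMeasurable]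
  have h2 := imh_chain_windowMSE_anyStart_le_explicit (q := q) hw0 hmax (μ₀.map Prod.snd) hf ha hc k hL
  rw [← hE] at h2
  exact h1.trans h2

section Replicas

variable {Ω' : Type*} {mΩ' : MeasurableSpace Ω'} {μ : Measure Ω'} [IsProbabilityMeasure μ]
  {Z : ℕ → Ω' → (ℕ → Ω × Ω)}

omit [IsProbabilityMeasure q] [IsProbabilityMeasure μ] in
/-- **The window read-out average along a replica has the variance of `A_L` under `P̂`** (transfer along the law). [ours, bookkeeping] -/
theorem windowReadout_replica_variance_eq {P : Measure (ℕ → Ω × Ω)} {f : Ω → ℝ} (hf : Measurable f) (k L : ℕ) {j : ℕ}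
    (hZm : Measurable (Z j)) (hlaw : μ.map (Z j) = P) :
    variance (fun ω => (∑ l ∈ range L, f ((Z j ω (k + l)).2)) / L) μ =
      variance (fun z : ℕ → Ω × Ω => (∑ l ∈ range L, f ((z (k + l)).2)) / L) P := by
  rw [← hlaw, variance_map (measurable_windowReadout hf k L).aemeasurable hZm.aemeasurable]
  rfl

/-! ## §2 Bernstein across replicas for the window read-out averages -/

/-- **BERNSTEIN FOR THE WINDOW READ-OUT AVERAGES**: `R` mutually independent pair streams with the common law `P̂` of the pair chain,
`a ≤ f ≤ c` measurable, `L ≥ 1`, `m_L = E_{P̂} A_L`; for every `σ² ≥ Var_{P̂} A_L` with `σ² > 0`, `ε ≥ 0`, `R ≥ 1`: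
`P(|R⁻¹Σ_{j<R} A_L(Z_j) − m_L| ≥ ε) ≤ 2·exp(−Rε²/(2(σ² + (c − a)ε/3)))`. [ours] -/
theorem windowReadout_replicas_bernstein_abs
    (Khat : Kernel (Ω × Ω) (Ω × Ω)) [IsMarkovKernel Khat]
    (ν : Measure (Ω × Ω)) [IsProbabilityMeasure ν] {f : Ω → ℝ} (hf : Measurable f) {a c : ℝ} (ha : ∀ x, a ≤ f x)
    (hc : ∀ x, f x ≤ c) (k : ℕ) {L : ℕ} (hL : L ≠ 0) (hZm : ∀ j, Measurable (Z j))
    (hlaw : ∀ j, μ.map (Z j) = Kernel.trajMeasure (X := fun _ : ℕ => Ω × Ω) ν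
      (fun n : ℕ => Khat.comap (fun h : (i : ↥(Finset.Iic n)) → Ω × Ω => h ⟨n, Finset.mem_Iic.2 le_rfl⟩)
        (measurable_pi_apply _)))
    (hind : iIndepFun Z μ) {σ2 : ℝ} (hσ : 0 < σ2)
    (hσL : variance (fun z : ℕ → Ω × Ω => (∑ l ∈ range L, f ((z (k + l)).2)) / L)
      (Kernel.trajMeasure (X := fun _ : ℕ => Ω × Ω) ν
        (fun n : ℕ => Khat.comap (fun h : (i : ↥(Finset.Iic n)) → Ω × Ω => h ⟨n, Finset.mem_Iic.2 le_rfl⟩)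
          (measurable_pi_apply _))) ≤ σ2)
    {ε : ℝ} (hε : 0 ≤ ε) {R : ℕ} (hR : 1 ≤ R) :
    μ.real {ω | ε ≤ |(R : ℝ)⁻¹ * ∑ j ∈ range R, (∑ l ∈ range L, f ((Z j ω (k + l)).2)) / L -
        ∫ z, (∑ l ∈ range L, f ((z (k + l)).2)) / L
          ∂(Kernel.trajMeasure (X := fun _ : ℕ => Ω × Ω) ν
            (fun n : ℕ => Khat.comap (fun h : (i : ↥(Finset.Iic n)) → Ω × Ω => h ⟨n, Finset.mem_Iic.2 le_rfl⟩)
              (measurable_pi_apply _)))|} ≤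
      2 * Real.exp (-(R * ε ^ 2) / (2 * (σ2 + (c - a) * ε / 3))) := by
  set P := Kernel.trajMeasure (X := fun _ : ℕ => Ω × Ω) ν
    (fun n : ℕ => Khat.comap (fun h : (i : ↥(Finset.Iic n)) → Ω × Ω => h ⟨n, Finset.mem_Iic.2 le_rfl⟩)
      (measurable_pi_apply _)) with hP
  haveI : IsProbabilityMeasure P := by rw [hP]; infer_instance
  have hAm : Measurable fun z : ℕ → Ω × Ω => (∑ l ∈ range L, f ((z (k + l)).2)) / L := measurable_windowReadout hf k L
  set mL := ∫ z, (∑ l ∈ range L, f ((z (k + l)).2)) / L ∂P with hmL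
  have hmean : ∀ j, μ[fun ω => (∑ l ∈ range L, f ((Z j ω (k + l)).2)) / L] = mL := fun j =>
    integral_comp_eq_of_map_eq (hZm j) (hlaw j) hAm
  -- `m_L ∈ [a, c]`
  have hmL_mem : a ≤ mL ∧ mL ≤ c := by
    have hAi : Integrable (fun z : ℕ → Ω × Ω => (∑ l ∈ range L, f ((z (k + l)).2)) / L) P :=
      Integrable.of_bound hAm.aestronglyMeasurable (max |a| |c|) (ae_of_all _ fun z => by
        rw [Real.norm_eq_abs]
        obtain ⟨h1, h2⟩ := windowReadout_mem_Icc ha hc k hL z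
        exact abs_le_max_abs_abs h1 h2)
    constructor
    · calc a = ∫ _, a ∂P := by simp
        _ ≤ mL := integral_mono (integrable_const _) hAi fun z => (windowReadout_mem_Icc ha hc k hL z).1
    · calc mL ≤ ∫ _, c ∂P := integral_mono hAi (integrable_const _) fun z => (windowReadout_mem_Icc ha hc k hL z).2
        _ = c := by simp
  have hbd : ∀ j ω, |(∑ l ∈ range L, f ((Z j ω (k + l)).2)) / L - mL| ≤ c - a := fun j ω => by
    obtain ⟨h1, h2⟩ := windowReadout_mem_Icc ha hc k hL (Z j ω)
    exact abs_sub_le_iff.2 ⟨by linarith, by linarith⟩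
  have hvar : ∀ j, variance (fun ω => (∑ l ∈ range L, f ((Z j ω (k + l)).2)) / L) μ ≤ σ2 := fun j => by
    rw [windowReadout_replica_variance_eq hf k L (hZm j) (hlaw j)]
    exact hσL
  exact bernstein_avg_abs (μ := μ) (X := fun j ω => (∑ l ∈ range L, f ((Z j ω (k + l)).2)) / L) (fun j => hAm.comp (hZm j))
    (hind.comp (fun _ => _) fun _ => hAm) hmean hbd hσ hvar hε hR

/-! ## §3 The coupled, burn-in-certified version about `π f`, and the cost -/

/-- **BERNSTEIN FOR THE TIME-AVERAGED COUPLED ESTIMATES, ABOUT `π f`**: `MeasurableEq Ω`, `w` maximal at `x₀` (`W = w(x₀)`,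
`r = 1 − 1/W`), `p₀ = ν̂(Δᶜ)`; for every `σ² ≥ Var_{P̂} A_L` with `σ² > 0`, `ε ≥ 0`, `R ≥ 1`, `L ≥ 1`, every `N`:
`P(|R⁻¹Σ_{j<R} H̄_L(Z_j) − π f| ≥ ε + r^k(c − a)) ≤ 2·exp(−Rε²/(2(σ² + (c − a)ε/3))) + R·r^k·p₀`,
`H̄_L(z) = (1/L)Σ_{l<L}(f((z(k+l)).2) + Σ_{n<N}(f((z(k+l+n)).1) − f((z(k+l+n)).2)))`. [ours] -/
theorem crnLagAvg_replicas_burnIn_bernstein_abs_target [MeasurableEq Ω] [Fact (Measurable w)] (hw0 : ∀ y, 0 < w y) {x₀ : Ω}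
    (hmax : ∀ y, w y ≤ w x₀) [IsProbabilityMeasure (q.withDensity fun y => ENNReal.ofReal (w y))]
    (Khat : Kernel (Ω × Ω) (Ω × Ω)) [IsMarkovKernel Khat]
    (hK : ∀ z : Ω × Ω, Khat z = (q.prod (volume : Measure unitInterval)).map (fun p : Ω × unitInterval =>
      ((if (p.2 : ℝ) * w z.1 ≤ w p.1 then p.1 else z.1), (if (p.2 : ℝ) * w z.2 ≤ w p.1 then p.1 else z.2))))
    (ν : Measure (Ω × Ω)) [IsProbabilityMeasure ν] {f : Ω → ℝ} (hf : Measurable f) {a c : ℝ} (ha : ∀ x, a ≤ f x)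
    (hc : ∀ x, f x ≤ c) (k N : ℕ) {L : ℕ} (hL : L ≠ 0) (hZm : ∀ j, Measurable (Z j))
    (hlaw : ∀ j, μ.map (Z j) = Kernel.trajMeasure (X := fun _ : ℕ => Ω × Ω) ν
      (fun n : ℕ => Khat.comap (fun h : (i : ↥(Finset.Iic n)) → Ω × Ω => h ⟨n, Finset.mem_Iic.2 le_rfl⟩)
        (measurable_pi_apply _)))
    (hind : iIndepFun Z μ) {σ2 : ℝ} (hσ : 0 < σ2)
    (hσL : variance (fun z : ℕ → Ω × Ω => (∑ l ∈ range L, f ((z (k + l)).2)) / L)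
      (Kernel.trajMeasure (X := fun _ : ℕ => Ω × Ω) ν
        (fun n : ℕ => Khat.comap (fun h : (i : ↥(Finset.Iic n)) → Ω × Ω => h ⟨n, Finset.mem_Iic.2 le_rfl⟩)
          (measurable_pi_apply _))) ≤ σ2)
    {ε : ℝ} (hε : 0 ≤ ε) {R : ℕ} (hR : 1 ≤ R) :
    μ.real {ω | ε + (1 - (w x₀)⁻¹) ^ k * (c - a) ≤
        |(R : ℝ)⁻¹ * ∑ j ∈ range R, (∑ l ∈ range L, (f ((Z j ω (k + l)).2) +
            ∑ n ∈ range N, (f ((Z j ω (k + l + n)).1) - f ((Z j ω (k + l + n)).2)))) / L -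
          ∫ x, f x ∂(q.withDensity fun y => ENNReal.ofReal (w y))|} ≤
      2 * Real.exp (-(R * ε ^ 2) / (2 * (σ2 + (c - a) * ε / 3))) + R * ((1 - (w x₀)⁻¹) ^ k * ν.real (Set.diagonal Ω)ᶜ) := by
  set P := Kernel.trajMeasure (X := fun _ : ℕ => Ω × Ω) ν
    (fun n : ℕ => Khat.comap (fun h : (i : ↥(Finset.Iic n)) → Ω × Ω => h ⟨n, Finset.mem_Iic.2 le_rfl⟩)
      (measurable_pi_apply _)) with hP
  set mL := ∫ z, (∑ l ∈ range L, f ((z (k + l)).2)) / L ∂P with hmL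
  set πf := ∫ x, f x ∂(q.withDensity fun y => ENNReal.ofReal (w y)) with hπf
  set B : Set Ω' := ⋃ j ∈ range R, {ω | ∃ m, k ≤ m ∧ Z j ω m ∉ Set.diagonal Ω} with hB
  have hbias : |mL - πf| ≤ (1 - (w x₀)⁻¹) ^ k * (c - a) := windowReadout_integral_sub_abs_le hw0 hmax Khat hK ν hf ha hc k hL
  -- off `B` every correction of every replica vanishes, so the time-averaged coupled estimate is the window read-out average
  have hsub : {ω | ε + (1 - (w x₀)⁻¹) ^ k * (c - a) ≤
        |(R : ℝ)⁻¹ * ∑ j ∈ range R, (∑ l ∈ range L, (f ((Z j ω (k + l)).2) +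
            ∑ n ∈ range N, (f ((Z j ω (k + l + n)).1) - f ((Z j ω (k + l + n)).2)))) / L - πf|}
      ⊆ B ∪ {ω | ε ≤ |(R : ℝ)⁻¹ * ∑ j ∈ range R, (∑ l ∈ range L, f ((Z j ω (k + l)).2)) / L - mL|} := by
    intro ω hω
    by_cases hωB : ω ∈ B
    · exact Or.inl hωB
    · right
      have hzero : ∀ j ∈ range R, ∀ l n, f ((Z j ω (k + l + n)).1) - f ((Z j ω (k + l + n)).2) = 0 := by
        intro j hj l n
        have hmem : Z j ω (k + l + n) ∈ Set.diagonal Ω := by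
          by_contra hne
          exact hωB (Set.mem_biUnion (show j ∈ (range R : Set ℕ) from by exact_mod_cast hj)
            ⟨k + l + n, by omega, hne⟩)
        rw [Set.mem_diagonal_iff.1 hmem, sub_self]
      have hsum : ∑ j ∈ range R, (∑ l ∈ range L, (f ((Z j ω (k + l)).2) +
            ∑ n ∈ range N, (f ((Z j ω (k + l + n)).1) - f ((Z j ω (k + l + n)).2)))) / L =
          ∑ j ∈ range R, (∑ l ∈ range L, f ((Z j ω (k + l)).2)) / L :=
        sum_congr rfl fun j hj => by
          congr 1
          exact sum_congr rfl fun l _ => by rw [sum_eq_zero fun n _ => hzero j hj l n, add_zero]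
      simp only [Set.mem_setOf_eq] at hω ⊢
      rw [hsum] at hω
      have htri : |(R : ℝ)⁻¹ * ∑ j ∈ range R, (∑ l ∈ range L, f ((Z j ω (k + l)).2)) / L - πf| ≤
          |(R : ℝ)⁻¹ * ∑ j ∈ range R, (∑ l ∈ range L, f ((Z j ω (k + l)).2)) / L - mL| + |mL - πf| :=
        abs_sub_le _ mL πf
      linarith
  have hBle : μ.real B ≤ R * ((1 - (w x₀)⁻¹) ^ k * ν.real (Set.diagonal Ω)ᶜ) :=
    calc μ.real B ≤ ∑ j ∈ range R, μ.real {ω | ∃ m, k ≤ m ∧ Z j ω m ∉ Set.diagonal Ω} := measureReal_biUnion_finset_le _ _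
      _ ≤ ∑ j ∈ range R, (1 - (w x₀)⁻¹) ^ k * ν.real (Set.diagonal Ω)ᶜ :=
          sum_le_sum fun j _ => crnLag_replica_notMerged_after_le hw0 hmax Khat hK ν k hZm (hlaw j)
      _ = R * ((1 - (w x₀)⁻¹) ^ k * ν.real (Set.diagonal Ω)ᶜ) := by rw [sum_const, card_range, nsmul_eq_mul]
  have h2 := windowReadout_replicas_bernstein_abs Khat ν hf ha hc k hL hZm hlaw hind hσ hσL hε hR
  calc μ.real {ω | ε + (1 - (w x₀)⁻¹) ^ k * (c - a) ≤
          |(R : ℝ)⁻¹ * ∑ j ∈ range R, (∑ l ∈ range L, (f ((Z j ω (k + l)).2) +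
              ∑ n ∈ range N, (f ((Z j ω (k + l + n)).1) - f ((Z j ω (k + l + n)).2)))) / L - πf|}
      ≤ μ.real (B ∪ {ω | ε ≤ |(R : ℝ)⁻¹ * ∑ j ∈ range R, (∑ l ∈ range L, f ((Z j ω (k + l)).2)) / L - mL|}) :=
        measureReal_mono hsub
    _ ≤ μ.real B + μ.real {ω | ε ≤ |(R : ℝ)⁻¹ * ∑ j ∈ range R, (∑ l ∈ range L, f ((Z j ω (k + l)).2)) / L - mL|} :=
        measureReal_union_le _ _
    _ ≤ 2 * Real.exp (-(R * ε ^ 2) / (2 * (σ2 + (c - a) * ε / 3))) + R * ((1 - (w x₀)⁻¹) ^ k * ν.real (Set.diagonal Ω)ᶜ) := by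
        linarith

/-- **THE CERTIFIED COST OF A MEASUREMENT**: with `σ_L² = (2W − 1)Var_π f/L + r^k·max(π f − a, c − π f)²` (assumed positive),
`P(|R⁻¹Σ_{j<R} H̄_L(Z_j) − π f| ≥ ε + r^k(c − a)) ≤ 2·exp(−Rε²/(2(σ_L² + (c − a)ε/3))) + R·r^k·p₀` — exponent
`R·L·ε²/(2(2W − 1)Var_π f)·(1 + o(1))`: a total of `≈ 2(2W − 1)·Var_π f·log(2/δ)/ε²` update rounds certifies accuracy `ε` at confidence `1 − δ`. [ours] -/
theorem crnLagAvg_replicas_burnIn_bernstein_cost [MeasurableEq Ω] [Fact (Measurable w)] (hw0 : ∀ y, 0 < w y) {x₀ : Ω}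
    (hmax : ∀ y, w y ≤ w x₀) [IsProbabilityMeasure (q.withDensity fun y => ENNReal.ofReal (w y))]
    (Khat : Kernel (Ω × Ω) (Ω × Ω)) [IsMarkovKernel Khat]
    (hK : ∀ z : Ω × Ω, Khat z = (q.prod (volume : Measure unitInterval)).map (fun p : Ω × unitInterval =>
      ((if (p.2 : ℝ) * w z.1 ≤ w p.1 then p.1 else z.1), (if (p.2 : ℝ) * w z.2 ≤ w p.1 then p.1 else z.2))))
    (ν : Measure (Ω × Ω)) [IsProbabilityMeasure ν] {f : Ω → ℝ} (hf : Measurable f) {a c : ℝ} (ha : ∀ x, a ≤ f x)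
    (hc : ∀ x, f x ≤ c) (k N : ℕ) {L : ℕ} (hL : L ≠ 0) (hZm : ∀ j, Measurable (Z j))
    (hlaw : ∀ j, μ.map (Z j) = Kernel.trajMeasure (X := fun _ : ℕ => Ω × Ω) ν
      (fun n : ℕ => Khat.comap (fun h : (i : ↥(Finset.Iic n)) → Ω × Ω => h ⟨n, Finset.mem_Iic.2 le_rfl⟩)
        (measurable_pi_apply _)))
    (hind : iIndepFun Z μ)
    (hpos : 0 < (2 * w x₀ - 1) *
          (∫ x, (f x - ∫ z, f z ∂(q.withDensity fun y => ENNReal.ofReal (w y))) ^ 2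
            ∂(q.withDensity fun y => ENNReal.ofReal (w y))) / L +
        (1 - (w x₀)⁻¹) ^ k *
          (max (∫ z, f z ∂(q.withDensity fun y => ENNReal.ofReal (w y)) - a)
            (c - ∫ z, f z ∂(q.withDensity fun y => ENNReal.ofReal (w y)))) ^ 2)
    {ε : ℝ} (hε : 0 ≤ ε) {R : ℕ} (hR : 1 ≤ R) :
    μ.real {ω | ε + (1 - (w x₀)⁻¹) ^ k * (c - a) ≤
        |(R : ℝ)⁻¹ * ∑ j ∈ range R, (∑ l ∈ range L, (f ((Z j ω (k + l)).2) +
            ∑ n ∈ range N, (f ((Z j ω (k + l + n)).1) - f ((Z j ω (k + l + n)).2)))) / L -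
          ∫ x, f x ∂(q.withDensity fun y => ENNReal.ofReal (w y))|} ≤
      2 * Real.exp (-(R * ε ^ 2) / (2 * ((2 * w x₀ - 1) *
          (∫ x, (f x - ∫ z, f z ∂(q.withDensity fun y => ENNReal.ofReal (w y))) ^ 2
            ∂(q.withDensity fun y => ENNReal.ofReal (w y))) / L +
        (1 - (w x₀)⁻¹) ^ k *
          (max (∫ z, f z ∂(q.withDensity fun y => ENNReal.ofReal (w y)) - a)
            (c - ∫ z, f z ∂(q.withDensity fun y => ENNReal.ofReal (w y)))) ^ 2 + (c - a) * ε / 3))) +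
        R * ((1 - (w x₀)⁻¹) ^ k * ν.real (Set.diagonal Ω)ᶜ) := by
  have hσL := windowReadout_variance_le hw0 hmax Khat hK ν hf ha hc k hL
  exact crnLagAvg_replicas_burnIn_bernstein_abs_target hw0 hmax Khat hK ν hf ha hc k N hL hZm hlaw hind hpos hσL hε hR

end Replicas

end Summit.Ventures.LatticeQCDFlow.Exactness

end
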